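import Mathlib
import HarnessLib
import HarnessLib.Audit
import Summits.HubbardSuperconductivity.Statement
import Literature.MathematicalPhysics.QuantumLattice.PairCorrelationsProofs
import HarnessLib.Audit.Status.Attr

/-!
Route: FixedNodeShadow

Route FixedNodeShadow — HubbardSuperconductivity/HubbardSuperconductivity (plancard, card
HubbardSuperconductivity/HubbardSuperconductivity/fixed-node-shadow-node-release; novelty audit:
new-combination).
THESIS X (it suffices to show) = ANCHOR ∧ RELEASE for the lattice fixed-node ('shadow') deformation
of the summit's own matrix. Work in the occupation basis s : Finset (Orb Λ_L) of the even tori (Fock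
= Finset Orb → ℂ; hopping entries of H_L = hubbardTorus 2 L 1 U are real ±1, U is diagonal). A TRIAL
FAMILY is φ : ∀ L, Finset (Orb Λ_L) → ℝ; it is ADMISSIBLE at doping δ if φ_L(s) ≠ 0 on every
configuration of the (N_L, S^z=0) class (#s = N_L, #up = N_L/2) and vanishes off it. The fixed-node
matrix F_L = FN(H_L, φ_L) (ten Haaf–van Bemmel–van Leeuwen–van Saarloos–Ceperley 1995;
Gubernatis–Kawashima–Werner 2016 §11.2 (11.2)–(11.4)) deletes the BAD hops (Re H_{ss'}·φ(s)φ(s') >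
0) and adds the sign-flip potential Σ_bad Re H_{ss''} φ(s'')/φ(s) to the diagonal; it is written
INLINE, entrywise, in every item. Node-release path: H_γ = H_L + γ(F_L − H_L), γ ∈ [0,1], H_0 = H_L
(the summit's matrix), H_1 = F_L (stoquastic in the signed basis sgn φ(s)|s⟩, Perron–Frobenius
ground state with EXACTLY the sign structure of φ).
(ANCHOR, FnAnchorOrder, rank 2) ∃ U>0, δ∈(0,1/2), an admissible trial family φ with d-wave
pair-field order of its own (a·L⁴·‖φ_L‖² ≤ Re⟨φ_L, Δ_d†Δ_d φ_L⟩) such that EVERY normalised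
(N_L,0)-sector ground state ψ of the shadow F_L has a·L⁴ ≤ Re⟨ψ, Δ_d†Δ_d ψ⟩ for all large even L
(Δ_d = pairField dWaveFormFactor L).
(RELEASE, FnNodeRelease, rank 3) for every (U, δ, φ, a) as in ANCHOR the order persists along the
whole node-release path: ∃ a'>0, for all large even L, every normalised sector ground state of H_γ,
γ ∈ [0,1], has a'·L⁴ ≤ Re⟨ψ, Δ_d†Δ_d ψ⟩.
X := FnAnchorOrder ∧ FnNodeRelease (one-line Lean form; both decls elaborate, rc 0 in the planner's
sketch; constants: Literature.MathematicalPhysics.QuantumLattice.hubbardTorus /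
IsGroundStateInSector / expect / pairField / dWaveFormFactor / Orb / FermionTorus, Matrix.of,
Matrix.minEnergyOn, HubbardSuperconductivity). At γ = 0 the path statement is the summit's
hypothesis verbatim, so FnTarget → HubbardSuperconductivity (FnPathAtZero) is bookkeeping (pointwise
bound along even sides ⇒ HasLongRangeOrder of torusPullback (pairFieldCorr dWaveFormFactor ψ), as in
PlaquetteBoson.PbContinuation / WeakCouplingBCS stmt-0160). Assembly := FnAnchorOrder →
FnNodeRelease → HubbardSuperconductivity (pure logic + FnPathAtZero; the glue FnAnchorOrder →
FnNodeRelease → FnTarget is `rintro ⟨U,hU,δ,hδ,φ,a,ha,hA⟩ hR; obtain ⟨a',ha',h⟩ := hR U δ φ a hU hδ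
ha hA; exact ⟨U,hU,δ,hδ,φ,a',ha',h⟩`, checked rc 0).
TWO-LAYER PLAN (D-0019). Layer 1 = ranked cruxes FnAnchorOrder (2) · FnNodeRelease (3) ·
FnTrialState (4: an admissible, sector-supported, d-wave-ordered trial family whose GOOD-hop graph
is connected on the sector class — the sign-exactness input, cheapest to refute by exact enumeration
at L = 4). Layer 2 (filed at the first split of FnAnchorOrder, NOT now): the card's factorisation
shadow-order = (pair-move SIGN COHERENCE of the trial determinant/pfaffian) × (AMPLITUDE comparison
of the Perron vector with |φ| in the ground-state-transformed picture: p/φ is the principal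
eigenvector of −L + E_loc on the good-hop graph, L the φ²-reversible jump generator with rates
|H_{ss'}|φ(s')/φ(s), E_loc = (Hφ)/φ the VMC local energy), the explicit witness (Gutzwiller ×
number-projected d-wave BCS with a generic admissible lift; definition requested) and LRO of the
trial state itself (shared with card projected-bcs-determinantal-gas). Support (rank 9, provable
now, Literature-grade transcriptions): FnDomination (F1: F − H = Σ_bad positive rank-one, ⪰ 0,
kernel ∋ φ, F = H + Δ), FnSignedPerron (F2: signed-stoquastic + unique positive Perron ground state
on a connected good graph — corollary of the tree's PROVED perronFrobenius_groundState_pos),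
FnEnergyWindow (F3: γ ↦ E(γ) non-decreasing, concave, inside [E₀, E_φ]), FnPathAtZero. Target
FnTarget (rank 0) = the path statement with its admissibility clause.

Rationale: WHY THIS LINE. Every anchor-and-continue route on this summit needs an end of the path where
positivity rules. PlaquetteBoson reaches reflection positivity by deforming the LATTICE; this route
keeps lattice, couplings, filling and symmetry fixed and deforms only the SIGN TREATMENT of a
sparse, U-independent set of hops: the lattice fixed-node construction (TenhaafEtAl1995,
VanbemmelEtAl1994; textbook GubernatisKawashimaWerner2016 §11.2–11.4, BeccaSorella2017) casts, from
ANY admissible real trial state φ, a shadow F = H + Δ_FN with three exact finite-dimensional facts —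
domination Δ_FN ⪰ 0 with Δ_FN φ = 0 (F1), stoquasticity in the signed basis sgn φ hence a UNIQUE
Perron ground state whose fermionic sign structure is EXACTLY sgn φ (F2; Perron–Frobenius is proved
in the tree), and the node-release family H_γ = H + γΔ_FN whose sector energy E(γ) is
non-decreasing, concave and confined to the variational window [E₀, E_φ] (F3; the γ-family is
Sorella's numerical device SorellaCapriotti2000, Sorella2003, whose fixed-node end found d-wave
order in the 2D t-J model, SorellaEtAl2002). Read as a ROUTE: at γ = 1 the d_{x²−y²} sign structure
of Anderson's Gutzwiller-projected BCS state (Anderson1987, ZhangGrosRiceShiba1988,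
ParamekantiRanderiaTrivedi2004, EdeggerMuthukumarGros2007) is imposed by theorem and the open
question is a statement about the principal eigenvector of an entrywise-signed nonnegative matrix
(positive-measure mathematics: Doob transform, Feynman–Kac, Dirichlet forms); releasing γ → 0
changes the Hamiltonian only on the bad hops and moves the energy by at most (E_φ − E₀) = ε_φ·L² in
total. Imported areas: Perron–Frobenius / sub-Markovian semigroups (probability), variational Monte
Carlo wave functions as explicit combinatorial objects (determinants of the d-wave pair amplitude),
certified exact enumeration on L = 4 tori. Catalogue entries used: deformation/continuity to a
positivity point; physical analogy WITH dictionary (FN-GFMC guiding function ↦ signed basis;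
sign-flip weight ↦ ⟨Δ_FN⟩; released node ↦ γ); certified computation (kill switch).
RANKED CRUXES. (2) FnAnchorOrder — the anchor theorem: some admissible d-wave-ordered trial family
has a shadow all of whose sector ground states carry d-wave pair-field order ≥ aL⁴; Literature-grade
alone ('the fixed-node Hamiltonian of a Gutzwiller–RVB state is a d-wave superconductor'); hardest
and most informative; honest meta-obstacle recorded in BARRIERS: U(1) ground-state order in d = 2
has so far been proved only by reflection positivity and F is not RP — the bet is the extra
structure a generic Bose problem lacks (a known positive quasi-mode φ with its own LRO; potential =
local energy with small variance density). (3) FnNodeRelease — persistence for γ ∈ [0,1]: the bet,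
tool-less like every continuation but with two handles no other path has (energy window,
configuration-sparse Δ_FN) and a sharp numerical instrument (γ-scan by FN/released-node GFMC). (4)
FnTrialState — admissible + sector-supported + connected good-hop graph + trial d-wave order: the
sign-exactness input; cheapest to refute (exact enumeration, L = 4, N ∈ {12, 14}); a planning-pass
finding is already built in: pure determinant/pfaffian d-wave states have symmetry-forced exact
zeros on some sector configurations, so admissibility needs a generic lift (hence ∃φ, not a named
state, in every item).
KILL CRITERIA. K1 (run first, refuter + kit): on L = 4 (N = 14, 12) and L = 6 if feasible, for the
Gutzwiller–dBCS family at (Δ_v, μ_v) fitted by VMC and a small generic lift: good-hop graph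
disconnected on the sector, or the shadow ground state without the B1g-alternating C₄ character, or
|φ|²-weighted bad-hop fraction ≥ 1/2 ⇒ retire FnTrialState's intended witness; if no admissible
d-wave family survives, close the route. K2 (γ-scan): FN/released-node GFMC on L = 8–12 tori at
(U,δ) ∈ {(8,0.2), (6,0.25), (4,0.25), (8,0.125)}: d-wave order parameter of GS(H_γ) for γ ∈ {2, 1,
0.5, 0.25, →0}; a collapse between γ = 1 and γ → 0 at every (U,δ) closes the route (keep F1–F3 and
FnTrialState as Literature targets); aim away from (8,1/8) first (PureModelStripeCompetition). K3:
FnAnchorOrder refuted for every admissible φ at all (U,δ) (shadow order → 0 with L) ⇒ close, and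
record the negative: FN-GFMC d-wave signals would be finite-size artefacts. K4: FnNodeRelease
refuted by an adversarial φ unrelated to d-wave trial states ⇒ restate with the side conditions the
refutation reveals (not a close).
DELIBERATELY NOT DECOMPOSED YET: the sign-coherence × amplitude split of FnAnchorOrder (layer 2),
the explicit witness (definition items: defn-fixedNodeMatrix for the inline FN matrix; the trial
family is the SAME object as route ProjectedBCSGas's inline χ[g,Δv,μ,δ] — requested as
`projectedBCSState` (defn-projectedBCSState, defn-projectedBCSState-2: real gauge + exact-zero
census wanted); wherever an item's informal text says 'gutzwillerDWaveBCS' read `projectedBCSState`;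
closed-shell / zone-diagonal conventions are fixed there), any mechanism for FnNodeRelease
(Kato/Feynman–Hellmann in the B1g pair channel; twist-gap protection — other cards), the γ → ∞
reduced problem on ker Δ_FN (a smaller stoquastic problem inside the same window), the
every-ground-state quantifier at γ < 1 (generic-u-schur card), odd L (unconstrained by the
Statement).
NOVELTY and BARRIERS: full text in the route's Novelty / Barriers fields (searched this pass: lit
search --hybrid 'fixed-node lattice fermions upper bound effective Hamiltonian sign-flip' →
GubernatisKawashimaWerner2016 pp. 375–383 read; crossref 'fixed-node effective Hamiltonian lattice
extrapolation gamma Sorella' → Sorella2003, SorellaCapriotti2000; crossref 'sign-problem-free QMC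
d-wave' → BergMetlitskiSachdev2012, LiYao2019; crossref 'Marshall sign rule Perron-Frobenius sign
structure superconductor d-wave' → Weng2011; lit galaxy --star all 'fixed-node approximation' →
BeccaSorella2017, Caffarel FN reviews (continuum); lit frontier HubbardSuperconductivity --since
2020: nothing on FN routes; negatives index empty).

Novelty: Searched this pass (tools and hits in the rationale): lit search --hybrid (local index;
GubernatisKawashimaWerner2016 §11.2–11.4 pp. 375–383 materialised and read: eqs. (11.2)–(11.4) =
this route's inline FN matrix; (11.8) = FnDomination; 'H|ψ_T⟩ = H_eff|ψ_T⟩' and E_T ≥ E_eff ≥ E_0 =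
FnEnergyWindow at γ = 1), lit search --source crossref ×3, lit galaxy search --star all 'fixed-node
approximation' (BeccaSorella2017; continuum FN reviews), lit frontier HubbardSuperconductivity
--since 2020 and lit bridges (nothing on fixed-node routes), the card's own audited search, ledger
negatives (empty). NEAREST PRIOR ART: TenhaafEtAl1995 (doi:10.1103/physrevb.51.13039) and
VanbemmelEtAl1994 — the lattice fixed-node effective Hamiltonian, the upper-bound proof as a sum of
positive squares over sign-flip pairs (= F1) and the Perron sign structure sgn ψ_T (= F2);
SorellaCapriotti2000, Sorella2003, BeccaSorella2017 — the one-parameter γ-family of effective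
Hamiltonians, its upper-bound/concavity property and γ-extrapolation toward the released (exact) end
(= F3); SorellaEtAl2002 — d-wave order found at the fixed-node end in the 2D t-J model (numerics);
BergMetlitskiSachdev2012 / LiYao2019 — the other 'positivity by design' family (determinantal
sign-free two-band models with d-wave tendencies), not connected to the pure Hubbard matrix by any
dominated path; Ceperley1991 (tiling theorem: continuum fermion nodes by theorem); Weng2011 (sign
structure of doped Mott insulators, no deformation). So  [refs: 10.1103/physrevb.51.13039, doi:10.1103/physrevb.51.13039, GubernatisKawashimaWerner2016, BeccaSorella2017, TenhaafEtAl1995, VanbemmelEtAl1994, SorellaCapriotti2000, Sorella2003, SorellaEtAl2002, BergMetlitskiSachdev2012, LiYao2019, Ceperley1991, Weng2011]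

Barriers (technique_class: fixed-node stoquastic deformation; Perron-Frobenius): technique_class: fixed-node stoquastic deformation; Perron-Frobenius
- Literature.Barriers.HubbardSuperconductivity.SignProblemNPHard: squarely in view and evaded
honestly — nothing here samples or cures the sign problem of H. The signs are FROZEN at γ ≥ 1 (the
shadow F is sign-free in the GIVEN basis sgn φ by construction, TenhaafEtAl1995) and released as the
deformation parameter; TroyerWiese2005 forbids a generic polynomial-time solution, not the existence
of a ψ_T-dependent dominating stoquastic matrix (which exists for every φ, FnDomination), and the
hardness of FINDING curing bases (MarvianLidarHen2019) is not met because the basis is prescribed,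
not searched. Numerics (K1 exact enumeration, K2 FN/released-node GFMC) are kill switches, never
certificates.
- Literature.Barriers.HubbardSuperconductivity.GeneralizedHartreeFockNoPairing: not in class — no
quasi-free state and no mean-field functional: the anchor ground state is (positive Perron
amplitude) × (sign of a Gutzwiller-projected d-wave determinant), Slater rank exponential in L²;
BachLiebSolovej1994 Thm 2.11 constrains nothing here.
- Literature.Barriers.HubbardSuperconductivity.LROForcesLowLyingStates: respected — every order
statement is fixed-N sector LRO ⟨Δ_d†Δ_d⟩ ≥ aL⁴ (no anomalous average, no gap hypothesis); the
Koma–Tasaki tower lives in other N-sectors of H_γ exactly as for H; at γ ≥ 1 'every ground state' is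
free (Perron uniqueness on a connected good graph, FnSignedPerron), at γ < 1 it is the summit's

sub-problem: HubbardSuperconductivity · status: open · opened planner-plancard-HubbardSuperconductivity-Hub-ec85cff3-0 2026-08-15T11:00:52Z · rev 3 · ledger route-HubbardSuperconductivity-FixedNodeShadow
GENERATED by the gate from the ledger (D-0016/17). Provers cite these decls: `theorem foo : Summit.HubbardSuperconductivity.HubbardSuperconductivity.Theses.FixedNodeShadow.<Decl> := …` in Summits/HubbardSuperconductivity/HubbardSuperconductivity/Theorems/<Name>.lean.
-/

namespace Summit.HubbardSuperconductivity.HubbardSuperconductivity.Theses.FixedNodeShadow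

open scoped BigOperators Topology Manifold Classical MeasureTheory ProbabilityTheory Matrix InnerProductSpace ComplexConjugate ContinuousMap
open Filter Set Function TopologicalSpace MeasureTheory

attribute [summit_statement] _root_.HubbardSuperconductivity

open Literature.Hubbard

/-- item stmt-HubbardSuperconductivity-2101 · target · rank 0 · open · by planner
why it might fail: = summit verbatim at γ=0 (pure t'=0 Hubbard may be striped, not d-wave ordered, at strong U: QinEtAl2020, XuEtAl2024) and also needs a nowhere-zero real trial family whose whole release path γ∈[0,1] stays ordered; fails if at every ordered (U,δ) GS zeros/degeneracies defeat all admissible φ.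
sources: ArovasBergKivelsonRaghu2022, Scalapino1995, QinEtAl2020, XuEtAl2024, TenhaafEtAl1995
[target] X = the node-release PATH statement: ∃ U>0, δ∈(0,1/2), a real trial family φ (φ_L : Finset
(Orb Λ_L) → ℝ), a'>0, L₁ such that for every even L ≥ L₁ (N_L = 2⌊(1−δ)L²/2⌋): φ_L is ADMISSIBLE
(nowhere zero on the (N_L, S^z=0) configuration class) and for every γ ∈ [0,1] every normalised
(N_L,0)-sector ground state ψ of H_γ = H_L + γ(FN(H_L,φ_L) − H_L), H_L = hubbardTorus 2 L 1 U, has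
a'·L⁴ ≤ Re⟨ψ, Δ_d†Δ_d ψ⟩ (Δ_d = pairField dWaveFormFactor L). FN(H,φ) is the lattice fixed-node
matrix written inline: bad(s,s') :⇔ s ≠ s' ∧ Re H_{ss'}·φ(s)φ(s') > 0; off-diagonal bad entries ↦ 0,
other entries kept; diagonal H_{ss} + Σ_{s'' bad} Re H_{ss''} φ(s'')/φ(s)
(GubernatisKawashimaWerner2016 (11.2)–(11.4); TenhaafEtAl1995). At γ = 0, H_γ = H_L literally
(checked: H + ((0:ℝ):ℂ)•(F − H) = H by simp), so FnPathAtZero : FnTarget → HubbardSuperconductivity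
is bookkeeping. The admissibility clause keeps X from collapsing to S with φ ≡ 0 (then F = H and the
'path' is constant): X is 'S together with a compatible fixed-node structure'. Conversely S plus a
nowhere-zero real ground state gives X (every ground state of H_γ ⪰ H at energy E₀ is a ground state
of H), so X is an honest reformulation of -/
@[route_item "route-HubbardSuperconductivity-FixedNodeShadow"]
def FnTarget : Prop :=
  ∃ U : ℝ, 0 < U ∧ ∃ δ ∈ Set.Ioo (0:ℝ) (1/2), ∃ φ : (∀ L : ℕ, Finset (Literature.MathematicalPhysics.QuantumLattice.Orb (Literature.MathematicalPhysics.QuantumLattice.FermionTorus 2 L)) → ℝ), ∃ a' : ℝ, 0 < a' ∧ ∃ L₁ : ℕ, ∀ (L : ℕ) [NeZero L], L₁ ≤ L → Even L → ∀ N : ℕ, N = 2 * ⌊(1 - δ) * (L : ℝ) ^ 2 / 2⌋₊ → (∀ s, (s.card = N ∧ 2 * (s.filter (fun o => (ofLex o).2 = 0)).card = N) → φ L s ≠ 0) ∧ ∀ γ ∈ Set.Icc (0:ℝ) 1, ∀ H, H = Literature.MathematicalPhysics.QuantumLattice.hubbardTorus 2 L 1 U → ∀ F, F = Matrix.of (fun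 s s' => if s = s' then H s s + ∑ s'', (if s'' ≠ s ∧ 0 < (H s s'').re * φ L s * φ L s'' then ((((H s s'').re * φ L s'' / φ L s : ℝ)) : ℂ) else 0) else (if 0 < (H s s').re * φ L s * φ L s' then 0 else H s s')) → ∀ ψ, star ψ ⬝ᵥ ψ = 1 → Literature.MathematicalPhysics.QuantumLattice.IsGroundStateInSector (H + (γ : ℂ) • (F - H)) N 0 ψ → a' * (L : ℝ) ^ 4 ≤ (Literature.MathematicalPhysics.QuantumLattice.expect ((Literature.MathematicalPhysics.QuantumLattice.pairField Literature.MathematicalPhysics.QuantumLattice.dWaveFormFactor L)ᴴ * Literature.MathematicalPhysics.QuantumLattice.pairField Literature.MathematicalPhysics.QuantumLattice.dWaveFormFactor L) ψ).re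

/-- item stmt-HubbardSuperconductivity-2103 · crux · rank 2 · open · by planner
why it might fail: U(1)-breaking GS order in d=2 is proved only via reflection positivity + infrared bounds (KLS1988PRL; LSSY2005 ch.11 p.117) and F is not RP; on the lattice the FN ground state depends on |φ| via V_sf (GKW2016 p.383), so the Perron reweighting p≠|φ| can decohere the determinant's pair-move signs.
sources: KLS1988PRL, LiebSeiringerSolovejYngvason2005, AizenmanEtAl2004, TenhaafEtAl1995, GubernatisKawashimaWerner2016, SorellaEtAl2002
[crux] ANCHOR THEOREM (card F2 + need (3)). ∃ U>0, δ∈(0,1/2), a real trial family φ, a>0, L₀: for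
every even L ≥ L₀ with N = N_L: (i) φ_L(s) ≠ 0 on every configuration s of the (N, S^z=0) class (#s
= N, #spin-up = N/2) and φ_L = 0 off that class; (ii) TRIAL ORDER a·L⁴·Σ_s φ_L(s)² ≤ Re⟨φ_L, Δ_d†Δ_d
φ_L⟩; (iii) SHADOW ORDER: every normalised (N,0)-sector ground state ψ of the fixed-node matrix F =
FN(hubbardTorus 2 L 1 U, φ_L) (inline; bad hops deleted, sign-flip potential added) has a·L⁴ ≤ Re⟨ψ,
Δ_d†Δ_d ψ⟩. By FnSignedPerron, on a connected good-hop graph (FnTrialState) the sector ground state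
of F is UNIQUE and equals sgn φ_L · (entrywise positive vector): the anchor's fermionic sign
structure is exactly the trial state's, by theorem. INTENDED WITNESS (prover's choice; definition
request gutzwillerDWaveBCS): φ_L = generic admissible lift of g^{D} · (Σ_{x,y} a(x−y)
c†_{x↑}c†_{y↓})^{N/2}|0⟩ with the d_{x²−y²} pair amplitude a(r) = L⁻² Σ_k [Δ_k/(ξ_k+√(ξ_k²+Δ_k²))]
cos(k·r), Δ_k = Δ_v(cos k₁ − cos k₂), ξ_k = −2(cos k₁ + cos k₂) − μ_v (Anderson1987,
ZhangGrosRiceShiba1988, ParamekantiRanderiaTrivedi2004), real in the occupation basis, zero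
momentum, singlet, B1g-alternating between N an -/
@[route_item "route-HubbardSuperconductivity-FixedNodeShadow", crux]
def FnAnchorOrder : Prop :=
  ∃ U : ℝ, 0 < U ∧ ∃ δ ∈ Set.Ioo (0:ℝ) (1/2), ∃ φ : (∀ L : ℕ, Finset (Literature.MathematicalPhysics.QuantumLattice.Orb (Literature.MathematicalPhysics.QuantumLattice.FermionTorus 2 L)) → ℝ), ∃ a : ℝ, 0 < a ∧ ∃ L₀ : ℕ, ∀ (L : ℕ) [NeZero L], L₀ ≤ L → Even L → ∀ N : ℕ, N = 2 * ⌊(1 - δ) * (L : ℝ) ^ 2 / 2⌋₊ → (∀ s, (s.card = N ∧ 2 * (s.filter (fun o => (ofLex o).2 = 0)).card = N) → φ L s ≠ 0) ∧ (∀ s, ¬ (s.card = N ∧ 2 * (s.filter (fun o => (ofLex o).2 = 0)).card = N) → φ L s = 0) ∧ a * (L : ℝ) ^ 4 * (∑ s, (φ L s) ^ 2) ≤ (Literature.MathematicalPhysics.QuantumLattice.expect ((Literature.MathematicalPhysics.QuantumLattice.pairField Literature.MathematicalPhysics.QuantumLattice.dWaveFormFactor L)ᴴ * Literature.MathematicalPhysics.QuantumLattice.pairField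 Literature.MathematicalPhysics.QuantumLattice.dWaveFormFactor L) (fun s => ((φ L s : ℝ) : ℂ))).re ∧ (∀ H, H = Literature.MathematicalPhysics.QuantumLattice.hubbardTorus 2 L 1 U → ∀ F, F = Matrix.of (fun s s' => if s = s' then H s s + ∑ s'', (if s'' ≠ s ∧ 0 < (H s s'').re * φ L s * φ L s'' then ((((H s s'').re * φ L s'' / φ L s : ℝ)) : ℂ) else 0) else (if 0 < (H s s').re * φ L s * φ L s' then 0 else H s s')) → ∀ ψ, star ψ ⬝ᵥ ψ = 1 → Literature.MathematicalPhysics.QuantumLattice.IsGroundStateInSector F N 0 ψ → a * (L : ℝ) ^ 4 ≤ (Literature.MathematicalPhysics.QuantumLattice.expect ((Literature.MathematicalPhysics.QuantumLattice.pairField Literature.MathematicalPhysics.QuantumLattice.dWaveFormFactor L)ᴴ * Literature.MathematicalPhysics.QuantumLattice.pairField Literature.MathematicalPhysics.QuantumLattice.dWaveFormFactor L) ψ).re)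

/-- item stmt-HubbardSuperconductivity-2104 · crux · rank 3 · open · by planner
why it might fail: ∀φ-implication: at γ=0 it asserts the summit at EVERY (U,δ) where some admissible φ has an ordered shadow; FN is biased toward ψ_T (GKW2016 p.383, BeccaSorella2017), so one ordered shadow over a striped true GS (U=8, δ=1/8: QinEtAl2020, XuEtAl2024) falsifies it; the energy window cannot control LRO.
sources: SorellaCapriotti2000, Sorella2003, BeccaSorella2017, GubernatisKawashimaWerner2016, QinEtAl2020, XuEtAl2024
[crux] NODE RELEASE γ: 1 → 0 (card F3 + need (4)), typed as an implication so that the Assembly is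
pure logic: for all U>0, δ∈(0,1/2), trial family φ, a>0, IF (the body of FnAnchorOrder at (U,δ,φ,a):
admissible + sector-supported + trial d-wave order + every sector ground state of the shadow F
ordered ≥ aL⁴, eventually in even L) THEN ∃ a'>0, L₁: for every even L ≥ L₁, φ_L admissible and for
every γ ∈ [0,1] every normalised (N_L,0)-sector ground state ψ of H_γ = H_L + γ(F − H_L) has a'·L⁴ ≤
Re⟨ψ, Δ_d†Δ_d ψ⟩. H_1 = F (checked by simp), H_0 = H_L. HANDLES NO OTHER CONTINUATION HAS: (a)
FnEnergyWindow — E(γ) = minEnergyOn(H_γ, sector) is non-decreasing, concave and E₀ ≤ E(γ) ≤ E_φ :=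
⟨φ,Hφ⟩/‖φ‖² for all γ ≥ 0, so by Feynman–Hellmann the node-crossing weight of the path's ground
state obeys ⟨Δ_FN⟩_γ = E'(γ) ≤ (E_φ − E₀)/γ = ε_φ L²/γ (ε_φ ≈ 10⁻² t for Gutzwiller–Jastrow–dBCS at
U ≈ 8, δ ≈ 0.1–0.2 by VMC/FN benchmarks); (b) Δ_FN = F − H_L is supported on the BAD hops only — a
U-independent, t-proportional, configuration-sparse set (a few per cent of the kinetic weight for a
good guiding function: the FN 'sign-flip weight'); (c) for γ ≥ 1, H_γ stays stoquastic in the signed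
basis (coeffic -/
@[route_item "route-HubbardSuperconductivity-FixedNodeShadow", crux]
def FnNodeRelease : Prop :=
  ∀ (U δ : ℝ) (φ : (∀ L : ℕ, Finset (Literature.MathematicalPhysics.QuantumLattice.Orb (Literature.MathematicalPhysics.QuantumLattice.FermionTorus 2 L)) → ℝ)) (a : ℝ), 0 < U → δ ∈ Set.Ioo (0:ℝ) (1/2) → 0 < a → (∃ L₀ : ℕ, ∀ (L : ℕ) [NeZero L], L₀ ≤ L → Even L → ∀ N : ℕ, N = 2 * ⌊(1 - δ) * (L : ℝ) ^ 2 / 2⌋₊ → (∀ s, (s.card = N ∧ 2 * (s.filter (fun o => (ofLex o).2 = 0)).card = N) → φ L s ≠ 0) ∧ (∀ s, ¬ (s.card = N ∧ 2 * (s.filter (fun o => (ofLex o).2 = 0)).card = N) → φ L s = 0) ∧ a * (L : ℝ) ^ 4 * (∑ s, (φ L s) ^ 2) ≤ (Literature.MathematicalPhysics.QuantumLattice.expect ((Literature.MathematicalPhysics.QuantumLattice.pairField Literature.MathematicalPhysics.QuantumLattice.dWaveFormFactor L)ᴴ * Literature.MathematicalPhysics.QuantumLattice.pairField Literature.MathematicalPhysics.QuantumLattice.dWaveFormFactor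 L) (fun s => ((φ L s : ℝ) : ℂ))).re ∧ (∀ H, H = Literature.MathematicalPhysics.QuantumLattice.hubbardTorus 2 L 1 U → ∀ F, F = Matrix.of (fun s s' => if s = s' then H s s + ∑ s'', (if s'' ≠ s ∧ 0 < (H s s'').re * φ L s * φ L s'' then ((((H s s'').re * φ L s'' / φ L s : ℝ)) : ℂ) else 0) else (if 0 < (H s s').re * φ L s * φ L s' then 0 else H s s')) → ∀ ψ, star ψ ⬝ᵥ ψ = 1 → Literature.MathematicalPhysics.QuantumLattice.IsGroundStateInSector F N 0 ψ → a * (L : ℝ) ^ 4 ≤ (Literature.MathematicalPhysics.QuantumLattice.expect ((Literature.MathematicalPhysics.QuantumLattice.pairField Literature.MathematicalPhysics.QuantumLattice.dWaveFormFactor L)ᴴ * Literature.MathematicalPhysics.QuantumLattice.pairField Literature.MathematicalPhysics.QuantumLattice.dWaveFormFactor L) ψ).re)) → ∃ a' : ℝ, 0 < a' ∧ ∃ L₁ : ℕ, ∀ (L : ℕ) [NeZero L], L₁ ≤ L → Even L → ∀ N : ℕ, N = 2 * ⌊(1 - δ) * (L : ℝ) ^ 2 / 2⌋₊ → (∀ s,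 (s.card = N ∧ 2 * (s.filter (fun o => (ofLex o).2 = 0)).card = N) → φ L s ≠ 0) ∧ ∀ γ ∈ Set.Icc (0:ℝ) 1, ∀ H, H = Literature.MathematicalPhysics.QuantumLattice.hubbardTorus 2 L 1 U → ∀ F, F = Matrix.of (fun s s' => if s = s' then H s s + ∑ s'', (if s'' ≠ s ∧ 0 < (H s s'').re * φ L s * φ L s'' then ((((H s s'').re * φ L s'' / φ L s : ℝ)) : ℂ) else 0) else (if 0 < (H s s').re * φ L s * φ L s' then 0 else H s s')) → ∀ ψ, star ψ ⬝ᵥ ψ = 1 → Literature.MathematicalPhysics.QuantumLattice.IsGroundStateInSector (H + (γ : ℂ) • (F - H)) N 0 ψ → a' * (L : ℝ) ^ 4 ≤ (Literature.MathematicalPhysics.QuantumLattice.expect ((Literature.MathematicalPhysics.QuantumLattice.pairField Literature.MathematicalPhysics.QuantumLattice.dWaveFormFactor L)ᴴ * Literature.MathematicalPhysics.QuantumLattice.pairField Literature.MathematicalPhysics.QuantumLattice.dWaveFormFactor L) ψ).re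

/-- item stmt-HubbardSuperconductivity-2105 · crux · rank 4 · open · by planner
why it might fail: Needs ONE real φ with L^4 pair order AND a good-hop graph connected through all ~e^{cL^2} class configurations: d-wave determinants have symmetry-forced zeros and sign-erratic low-|φ| regions that can cut the graph (no lattice tiling theorem, cf. Ceperley1991); L^4 pair LRO of projected dBCS open.
sources: TenhaafEtAl1995, VanbemmelEtAl1994, Ceperley1991, ParamekantiRanderiaTrivedi2004, Anderson1987, ZhangGrosRiceShiba1988
[crux] SIGN-EXACT ADMISSIBLE d-WAVE TRIAL FAMILY (card need (2) + fastest refutation (i)). ∃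
δ∈(0,1/2), a real trial family φ, a>0, L₀: for every even L ≥ L₀ with N = N_L: (i) admissible:
φ_L(s) ≠ 0 on the (N, S^z=0) class; (ii) supported there; (iii) CONNECTED GOOD-HOP GRAPH: for every
U (the off-diagonal entries of hubbardTorus 2 L 1 U are the U-independent hopping signs) any two
class configurations are joined by a chain of GOOD hops, Re H_{bc}·φ_L(b)φ_L(c) < 0 — hence
(FnSignedPerron, from the tree's proved perronFrobenius_groundState_pos) the shadow F has a UNIQUE
sector ground state = sgn φ_L × (positive), i.e. the anchor is sign-exact; (iv) TRIAL d-WAVE ORDER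
a·L⁴·‖φ_L‖² ≤ Re⟨φ_L, Δ_d†Δ_d φ_L⟩. Intended witness: Gutzwiller × number-projected d_{x²−y²} BCS
(definition request gutzwillerDWaveBCS) with a generic admissible lift — PLANNING-PASS FINDING: the
pure determinant/pfaffian state has symmetry-forced EXACT ZEROS on sector configurations fixed by a
lattice reflection acting with character −1 (e.g. diagonal-mirror-symmetric configurations when the
permutation sign × B-character is −1), so 'nowhere zero' fails without a lift (or FN must be
restricted to supp φ, costing a no -/
@[route_item "route-HubbardSuperconductivity-FixedNodeShadow"]
def FnTrialState : Prop :=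
  ∃ δ ∈ Set.Ioo (0:ℝ) (1/2), ∃ φ : (∀ L : ℕ, Finset (Literature.MathematicalPhysics.QuantumLattice.Orb (Literature.MathematicalPhysics.QuantumLattice.FermionTorus 2 L)) → ℝ), ∃ a : ℝ, 0 < a ∧ ∃ L₀ : ℕ, ∀ (L : ℕ) [NeZero L], L₀ ≤ L → Even L → ∀ N : ℕ, N = 2 * ⌊(1 - δ) * (L : ℝ) ^ 2 / 2⌋₊ → (∀ s, (s.card = N ∧ 2 * (s.filter (fun o => (ofLex o).2 = 0)).card = N) → φ L s ≠ 0) ∧ (∀ s, ¬ (s.card = N ∧ 2 * (s.filter (fun o => (ofLex o).2 = 0)).card = N) → φ L s = 0) ∧ (∀ U : ℝ, ∀ H, H = Literature.MathematicalPhysics.QuantumLattice.hubbardTorus 2 L 1 U → ∀ s s', (s.card = N ∧ 2 * (s.filter (fun o => (ofLex o).2 = 0)).card = N) → (s'.card = N ∧ 2 * (s'.filter (fun o => (ofLex o).2 = 0)).card = N) → Relation.ReflTransGen (fun b c => (H b c).re * φ L b * φ L c < 0) s s') ∧ a * (L : ℝ) ^ 4 * (∑ s, (φ L s) ^ 2)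 ≤ (Literature.MathematicalPhysics.QuantumLattice.expect ((Literature.MathematicalPhysics.QuantumLattice.pairField Literature.MathematicalPhysics.QuantumLattice.dWaveFormFactor L)ᴴ * Literature.MathematicalPhysics.QuantumLattice.pairField Literature.MathematicalPhysics.QuantumLattice.dWaveFormFactor L) (fun s => ((φ L s : ℝ) : ℂ))).re

/-- item stmt-HubbardSuperconductivity-14223 · support · rank 9 · closed · proved by Summit.HubbardSuperconductivity.HubbardSuperconductivity.Theorems.fnTargetOfAnchorRelease_proof (prover) · by planner
sources: TenhaafEtAl1995, SorellaCapriotti2000, idea:HubbardSuperconductivity/HubbardSuperconductivity/fixed-node-shadow-node-release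
[support] GLUE TO THE TARGET (pure logic, provable now): ANCHOR (FnAnchorOrder) and RELEASE
(FnNodeRelease) imply the node-release path statement FnTarget. Proof, kernel-checked rc 0 against
the route module in the planner's Sketch.lean (2026-08-16): `rintro ⟨U,hU,δ,hδ,φ,a,ha,hbody⟩ hR;
obtain ⟨a',ha',L₁,hpath⟩ := hR U δ φ a hU hδ ha hbody; exact ⟨U,hU,δ,hδ,φ,a',ha',L₁,hpath⟩` — the
same lines that open the deciding theorem `closes`. ROLE: makes the target reachable in the item
graph (ranked cruxes FnAnchorOrder, FnNodeRelease → FnTarget → HubbardSuperconductivity via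
FnPathAtZero), so FnTarget closes as soon as both cruxes do; the deciding theorem `closes (hA :
FnAnchorOrder) (hR : FnNodeRelease) : HubbardSuperconductivity` inlines this glue and the γ = 0
bookkeeping and is unchanged. FnTrialState (rank 4) deliberately stays outside the glue: it is the
refutable sign-exactness input of the intended witness and enters formally only at the layer-2 split
of FnAnchorOrder (route header, NOT DECOMPOSED YET). [deps: FnAnchorOrder, FnNodeRelease, FnTarget]
[difficulty: provable-now] -/
@[route_item "route-HubbardSuperconductivity-FixedNodeShadow"]
def FnTargetOfAnchorRelease : Prop :=
  FnAnchorOrder → FnNodeRelease → FnTarget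

/-- item stmt-HubbardSuperconductivity-2106 · support · rank 9 · closed · proved by Summit.HubbardSuperconductivity.HubbardSuperconductivity.Theorems.FixedNodeShadow.fnDomination_proof @ 8e06b6885030 (prover) · by planner
sources: TenhaafEtAl1995, GubernatisKawashimaWerner2016, BeccaSorella2017
[support] F1 DOMINATION (provable now; general finite index type n). For a complex matrix A with
real symmetric entries and any real vector f, the fixed-node correction D := FN(A,f) − A (inline:
D_{ii} = Σ_{k bad} Re A_{ik} f_k/f_i, D_{ij} = −A_{ij} on bad pairs, 0 otherwise; bad(i,k) :⇔ k ≠ i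
∧ Re A_{ik} f_i f_k > 0) is real symmetric, POSITIVE SEMIDEFINITE (Re⟨v,Dv⟩ = Σ_{bad {i,j}} Re
A_{ij} f_i f_j |v_i/f_i − v_j/f_j|² ≥ 0 — GubernatisKawashimaWerner2016 (11.8); TenhaafEtAl1995 eqs.
(10)–(13)), annihilates f (D f = 0: the shadow touches A along f), and FN(A,f) = A + D entrywise
(checked rc 0 by ext/split_ifs in the planner's Test.lean). No nonvanishing hypothesis is needed:
rows of nodal i carry no bad pairs. Consequences used by the route: F ⪰ H (E_FN ≥ E₀, the lattice FN
upper-bound theorem), Fφ = Hφ, and H_γ − H = γD ⪰ 0. -/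
@[route_item "route-HubbardSuperconductivity-FixedNodeShadow"]
def FnDomination : Prop :=
  ∀ (n : Type) [Fintype n] [DecidableEq n] (A : Matrix n n ℂ) (f : n → ℝ), (∀ i j, A i j = A j i) → (∀ i j, star (A i j) = A i j) → ∀ D : Matrix n n ℂ, D = Matrix.of (fun i j => if i = j then ∑ k, (if k ≠ i ∧ 0 < (A i k).re * f i * f k then ((((A i k).re * f k / f i : ℝ)) : ℂ) else 0) else (if 0 < (A i j).re * f i * f j then -A i j else 0)) → (∀ i j, D i j = D j i) ∧ (∀ i j, star (D i j) = D i j) ∧ (∀ v : n → ℂ, 0 ≤ (star v ⬝ᵥ D *ᵥ v).re) ∧ D *ᵥ (fun i => ((f i : ℝ) : ℂ)) = 0 ∧ Matrix.of (fun s s' => if s = s' then A s s + ∑ s'', (if s'' ≠ s ∧ 0 < (A s s'').re * f s * f s'' then ((((A s s'').re * f s'' / f s : ℝ)) : ℂ) else 0) else (if 0 < (A s s').re * f s * f s' then 0 else A s s')) = A + D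

/-- item stmt-HubbardSuperconductivity-2107 · support · rank 9 · closed · proved by Summit.HubbardSuperconductivity.HubbardSuperconductivity.Theorems.FixedNodeShadow.fnSignedPerron_proof @ a6b28414beae (prover) · by planner
sources: LiebWuPhysicaA2003, TenhaafEtAl1995, GubernatisKawashimaWerner2016
[support] F2 SIGNED STOQUASTICITY + PERRON (provable now from the tree). For A with real symmetric
entries and f NOWHERE ZERO: (a) the fixed-node matrix F = FN(A,f) satisfies Re F_{ij}·f_i f_j ≤ 0
for i ≠ j, i.e. S F S has non-positive off-diagonal entries for S = diag(sgn f) (good entries kept,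
bad ones zeroed); (b) if the GOOD graph {Re A_{bc} f_b f_c < 0} is connected then every ground-state
vector of F (F v = E v with E a lower bound of the quadratic form) is c · (sgn f_i · r_i) with r
entrywise > 0 — apply Literature.MathematicalPhysics.QuantumLattice.perronFrobenius_groundState_pos
(PROVED, LiebWuPhysicaA2003 §2) to S F S, whose graph contains the good graph. Hence uniqueness up
to phase (perronFrobenius_groundState_unique) and: the shadow's ground state has EXACTLY the sign
structure of the trial state. The sector version used by FnAnchorOrder is the reindexing of (b) to
the (N, S^z=0) configuration class (F is block-diagonal in the occupation basis since N and S^z are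
diagonal there). -/
@[route_item "route-HubbardSuperconductivity-FixedNodeShadow"]
def FnSignedPerron : Prop :=
  ∀ (n : Type) [Fintype n] [DecidableEq n] (A : Matrix n n ℂ) (f : n → ℝ), (∀ i j, A i j = A j i) → (∀ i j, star (A i j) = A i j) → (∀ i, f i ≠ 0) → (∀ i j, Relation.ReflTransGen (fun b c => (A b c).re * f b * f c < 0) i j) → ∀ F : Matrix n n ℂ, F = Matrix.of (fun s s' => if s = s' then A s s + ∑ s'', (if s'' ≠ s ∧ 0 < (A s s'').re * f s * f s'' then ((((A s s'').re * f s'' / f s : ℝ)) : ℂ) else 0) else (if 0 < (A s s').re * f s * f s' then 0 else A s s')) → (∀ i j, i ≠ j → (F i j).re * f i * f j ≤ 0) ∧ ∀ E : ℝ, (∀ v : n → ℂ, E * (star v ⬝ᵥ v).re ≤ (star v ⬝ᵥ F *ᵥ v).re) → ∀ v : n → ℂ, F *ᵥ v = (E : ℂ) • v → v ≠ 0 → ∃ (c : ℂ) (r : n → ℝ), (∀ i, 0 < r i) ∧ v = c • (fun i => (((Real.sign (f i) * r i : ℝ)) : ℂ))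

/-- item stmt-HubbardSuperconductivity-2108 · support · rank 9 · closed · proved by Summit.HubbardSuperconductivity.HubbardSuperconductivity.Theorems.FixedNodeShadow.fnEnergyWindow_proof @ 01b5adf7f479 (prover) · by planner
sources: TenhaafEtAl1995, SorellaCapriotti2000, Sorella2003, GubernatisKawashimaWerner2016
[support] F3 THE VARIATIONAL WINDOW OF THE NODE-RELEASE PATH (provable now; general n, any subspace
K). If D is positive semidefinite (Re⟨v,Dv⟩ ≥ 0), D w = 0 and 0 ≠ w ∈ K, then for all γ ≥ 0:
A.minEnergyOn K ≤ (A + γD).minEnergyOn K ≤ Re⟨w,Aw⟩/Re⟨w,w⟩ (lower: the quadratic form only grows;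
upper: test with w/‖w‖, on which γD vanishes), γ ↦ (A+γD).minEnergyOn K is non-decreasing and
CONCAVE (infimum of affine functions). With A = H_L, D = FN(H_L,φ_L) − H_L (FnDomination), K =
szSector N_L 0, w = φ_L: the whole path γ ∈ [0,∞) has sector ground energy in [E₀, E_φ], E(1) = E_FN
(the lattice FN upper bound E_φ ≥ E_FN ≥ E₀, GubernatisKawashimaWerner2016 p. 383), and by concavity
E'(γ) = ⟨D⟩_{GS(γ)} ≤ (E_φ − E₀)/γ: the released 'perturbation' is small in energy by exactly the
variational error of φ. Matrix.minEnergyOn is an sInf: provers need nonemptiness (w) and boundedness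
below on the unit sphere of K (finite dimension). -/
@[route_item "route-HubbardSuperconductivity-FixedNodeShadow"]
def FnEnergyWindow : Prop :=
  ∀ (n : Type) [Fintype n] [DecidableEq n] (A D : Matrix n n ℂ) (K : Submodule ℂ (n → ℂ)) (w : n → ℂ), (∀ v : n → ℂ, 0 ≤ (star v ⬝ᵥ D *ᵥ v).re) → D *ᵥ w = 0 → w ∈ K → w ≠ 0 → (∀ γ : ℝ, 0 ≤ γ → A.minEnergyOn K ≤ (A + (γ : ℂ) • D).minEnergyOn K ∧ (A + (γ : ℂ) • D).minEnergyOn K ≤ (star w ⬝ᵥ A *ᵥ w).re / (star w ⬝ᵥ w).re) ∧ (∀ γ₁ γ₂ : ℝ, 0 ≤ γ₁ → γ₁ ≤ γ₂ → (A + (γ₁ : ℂ) • D).minEnergyOn K ≤ (A + (γ₂ : ℂ) • D).minEnergyOn K) ∧ (∀ γ₁ γ₂ t : ℝ, 0 ≤ γ₁ → 0 ≤ γ₂ → t ∈ Set.Icc (0:ℝ) 1 → t * (A + (γ₁ : ℂ) • D).minEnergyOn K + (1 - t) * (A + (γ₂ : ℂ) • D).minEnergyOn K ≤ (A + ((t *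 γ₁ + (1 - t) * γ₂ : ℝ) : ℂ) • D).minEnergyOn K)

/-- item stmt-HubbardSuperconductivity-2109 · support · rank 9 · closed · proved by Summit.HubbardSuperconductivity.HubbardSuperconductivity.Theorems.FixedNodeShadow.fnPathAtZero_proof @ 7a61817f9e5e (prover) · by planner
sources: Scalapino1995, ArovasBergKivelsonRaghu2022
[support] γ = 0 BOOKKEEPING (provable now): FnTarget → HubbardSuperconductivity. Take (U, δ) from
FnTarget; given the summit's hypothesis (N L = N_L, ‖ψ_L‖ = 1, IsGroundStateInSector (hubbardTorus 2
L 1 U) (N L) 0 (ψ L) for even L), instantiate the path statement at γ = 0 (H + ((0:ℝ):ℂ) • (F − H) =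
H by simp; 0 ∈ Set.Icc 0 1) to get a'·L⁴ ≤ Re⟨ψ_L, Δ_d†Δ_d ψ_L⟩ for even L ≥ L₁ (NeZero L from L ≥
L₁ ≥ 1 w.l.o.g.), then expect((pairField g L)ᴴ pairField g L) ψ = Σ_{x,y} expect((localPair g L x)ᴴ
localPair g L y) ψ
(Literature.MathematicalPhysics.QuantumLattice.expect_pairField_conjTranspose_mul) turns the
pointwise bound into liminf_k (2k)⁻⁴ Σ_{x,y} pairFieldCorr g ψ (2k) x y ≥ a' > 0, i.e.
HasLongRangeOrder (fun k => halfOpenBox 2 (2k)) (fun k => torusPullback (pairFieldCorr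
dWaveFormFactor ψ) (2k)). Identical in its second half to PlaquetteBoson.PbContinuation's consequent
and to the WeakCouplingBCS sector-bookkeeping item; prove once, reuse. -/
@[route_item "route-HubbardSuperconductivity-FixedNodeShadow"]
def FnPathAtZero : Prop :=
  FnTarget → HubbardSuperconductivity

/-- item stmt-HubbardSuperconductivity-2102 · assembly · rank 1 · closed · proved by Summit.HubbardSuperconductivity.HubbardSuperconductivity.Theorems.fixedNodeShadow_assembly_proof (prover) · by planner
sources: Scalapino1995, idea:HubbardSuperconductivity/HubbardSuperconductivity/fixed-node-shadow-node-release
[assembly] FnAnchorOrder → FnNodeRelease → HubbardSuperconductivity. Proof = pure logic down to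
FnTarget (`rintro ⟨U,hU,δ,hδ,φ,a,ha,hA⟩ hR; obtain ⟨a',ha',h⟩ := hR U δ φ a hU hδ ha hA; exact
⟨U,hU,δ,hδ,φ,a',ha',h⟩`, rc 0 in the planner's sketch) followed by the γ = 0 bookkeeping
FnPathAtZero (support item). The typed support layer FnDomination / FnSignedPerron / FnEnergyWindow
is NOT needed by the Assembly; it is the provable-now toolbox (F1–F3 of the card) that provers of
the cruxes will cite with --supports. -/
@[route_item "route-HubbardSuperconductivity-FixedNodeShadow"]
def Assembly : Prop :=
  FnAnchorOrder → FnNodeRelease → HubbardSuperconductivity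

/-! D-0027 §2.1 — DECIDING THEOREM (planner-authored via `route open/edit --closes-file`; by planner-rbadge-HubbardSuperconductivity-FixedN-9a06540b-g2-0 2026-08-15T16:18:22Z):
its hypotheses are this route's items and its conclusion the sub-problem Statement (glue_lint), and it elaborates with this file. -/

@[closes "route-HubbardSuperconductivity-FixedNodeShadow"] theorem closes (hA : FnAnchorOrder) (hR : FnNodeRelease) : _root_.HubbardSuperconductivity := by
  -- (1) pure logic: ANCHOR + RELEASE ⟹ the node-release path statement (the body of `FnTarget`)
  obtain ⟨U, hU, δ, hδ, φ, a, ha, hbody⟩ := hA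
  obtain ⟨a', ha', L₁, hpath⟩ := hR U δ φ a hU hδ ha hbody
  -- (2) the summit: same `U`, `δ`; fix a sequence of normalised sector ground states along even sides
  refine ⟨U, hU, δ, hδ, fun N ψ hyp => ?_⟩
  -- (3) γ = 0 bookkeeping: `H + ((0:ℝ):ℂ) • (F - H) = H`, so the path statement at γ = 0 is the
  --     pointwise bound `a'·L⁴ ≤ Re⟨ψ_L, Δ_d†Δ_d ψ_L⟩` for every even side `L ≥ L₁`, `L ≠ 0`
  have hpt : ∀ (L : ℕ) [NeZero L], L₁ ≤ L → Even L →
      a' * (L : ℝ) ^ 4 ≤ (Literature.MathematicalPhysics.QuantumLattice.expect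
        ((Literature.MathematicalPhysics.QuantumLattice.pairField
            Literature.MathematicalPhysics.QuantumLattice.dWaveFormFactor L)ᴴ *
          Literature.MathematicalPhysics.QuantumLattice.pairField
            Literature.MathematicalPhysics.QuantumLattice.dWaveFormFactor L) (ψ L)).re := by
    intro L _ hL1 hLe
    obtain ⟨hN, hnorm, hgs⟩ := hyp L hLe
    refine (hpath L hL1 hLe (N L) hN).2 0 (Set.mem_Icc.2 ⟨le_rfl, zero_le_one⟩) _ rfl _ rfl
      (ψ L) hnorm ?_
    rw [Complex.ofReal_zero, zero_smul, add_zero]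
    exact hgs
  -- (4) the LRO sequence along even sides, identified with `L⁻⁴ Re⟨ψ_L, Δ_d†Δ_d ψ_L⟩`
  have key : ∀ (L : ℕ) [NeZero L],
      (∑ x ∈ Literature.Probability.LatticeModels.halfOpenBox 2 L,
          ∑ y ∈ Literature.Probability.LatticeModels.halfOpenBox 2 L,
            Literature.MathematicalPhysics.QuantumLattice.torusPullback
              (Literature.MathematicalPhysics.QuantumLattice.pairFieldCorr
                Literature.MathematicalPhysics.QuantumLattice.dWaveFormFactor ψ) L x y) /
          ((Literature.Probability.LatticeModels.halfOpenBox 2 L).card : ℝ) ^ 2 =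
        (Literature.MathematicalPhysics.QuantumLattice.expect
          ((Literature.MathematicalPhysics.QuantumLattice.pairField
              Literature.MathematicalPhysics.QuantumLattice.dWaveFormFactor L)ᴴ *
            Literature.MathematicalPhysics.QuantumLattice.pairField
              Literature.MathematicalPhysics.QuantumLattice.dWaveFormFactor L) (ψ L)).re /
          (L : ℝ) ^ 4 := by
    intro L hL
    obtain ⟨n, rfl⟩ : ∃ n, L = n + 1 := ⟨L - 1, by have := hL.out; omega⟩
    exact Literature.MathematicalPhysics.QuantumLattice.torusLROSeq_pairFieldCorr_succ _ ψ n
  -- (5) a priori upper bound of the two-point function of a normalised state (keeps `liminf` honest)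
  have bnd : ∀ L : ℕ, L ≠ 0 → star (ψ L) ⬝ᵥ ψ L = 1 → ∀ x y,
      Literature.MathematicalPhysics.QuantumLattice.pairFieldCorr
          Literature.MathematicalPhysics.QuantumLattice.dWaveFormFactor ψ L x y ≤
        (∑ e ∈ insert 0 Literature.MathematicalPhysics.QuantumLattice.unitSteps,
          ‖((Literature.MathematicalPhysics.QuantumLattice.dWaveFormFactor e / Real.sqrt 2 : ℝ) : ℂ)‖ *
            2) ^ 2 := by
    intro L hL0 hψ x y
    obtain ⟨n, rfl⟩ : ∃ n, L = n + 1 := ⟨L - 1, by omega⟩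
    exact Literature.MathematicalPhysics.QuantumLattice.pairFieldCorr_succ_le _ ψ n hψ x y
  -- (6) eventual lower bound `a' ≤ u k` along `L = 2k`, `k ≥ L₁ + 1`
  have hev : ∀ᶠ k : ℕ in atTop, a' ≤
      (∑ x ∈ Literature.Probability.LatticeModels.halfOpenBox 2 (2 * k),
          ∑ y ∈ Literature.Probability.LatticeModels.halfOpenBox 2 (2 * k),
            Literature.MathematicalPhysics.QuantumLattice.torusPullback
              (Literature.MathematicalPhysics.QuantumLattice.pairFieldCorr
                Literature.MathematicalPhysics.QuantumLattice.dWaveFormFactor ψ) (2 * k) x y) /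
          ((Literature.Probability.LatticeModels.halfOpenBox 2 (2 * k)).card : ℝ) ^ 2 := by
    refine eventually_atTop.2 ⟨L₁ + 1, fun k hk => ?_⟩
    have hk0 : 2 * k ≠ 0 := by omega
    haveI : NeZero (2 * k) := ⟨hk0⟩
    have hkL : L₁ ≤ 2 * k := by omega
    have hpos : (0 : ℝ) < ((2 * k : ℕ) : ℝ) ^ 4 :=
      pow_pos (by exact_mod_cast (by omega : 0 < 2 * k)) 4
    rw [key (2 * k), le_div_iff₀ hpos]
    exact hpt (2 * k) hkL (even_two_mul k)
  -- (7) eventual upper bound (coboundedness of the real `liminf`)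
  have hco : IsCoboundedUnder (· ≥ ·) atTop (fun k : ℕ =>
      (∑ x ∈ Literature.Probability.LatticeModels.halfOpenBox 2 (2 * k),
          ∑ y ∈ Literature.Probability.LatticeModels.halfOpenBox 2 (2 * k),
            Literature.MathematicalPhysics.QuantumLattice.torusPullback
              (Literature.MathematicalPhysics.QuantumLattice.pairFieldCorr
                Literature.MathematicalPhysics.QuantumLattice.dWaveFormFactor ψ) (2 * k) x y) /
          ((Literature.Probability.LatticeModels.halfOpenBox 2 (2 * k)).card : ℝ) ^ 2) := by
    refine isCoboundedUnder_ge_of_eventually_le _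
      (x := (∑ e ∈ insert 0 Literature.MathematicalPhysics.QuantumLattice.unitSteps,
          ‖((Literature.MathematicalPhysics.QuantumLattice.dWaveFormFactor e / Real.sqrt 2 : ℝ) : ℂ)‖ *
            2) ^ 2) ?_
    refine eventually_atTop.2 ⟨1, fun k hk => ?_⟩
    have hk0 : 2 * k ≠ 0 := by omega
    obtain ⟨-, hnorm, -⟩ := hyp (2 * k) (even_two_mul k)
    have hb := bnd (2 * k) hk0 hnorm
    refine div_le_of_le_mul₀ (by positivity) (by positivity) ?_
    calc (∑ x ∈ Literature.Probability.LatticeModels.halfOpenBox 2 (2 * k),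
          ∑ y ∈ Literature.Probability.LatticeModels.halfOpenBox 2 (2 * k),
            Literature.MathematicalPhysics.QuantumLattice.torusPullback
              (Literature.MathematicalPhysics.QuantumLattice.pairFieldCorr
                Literature.MathematicalPhysics.QuantumLattice.dWaveFormFactor ψ) (2 * k) x y)
        ≤ ∑ x ∈ Literature.Probability.LatticeModels.halfOpenBox 2 (2 * k),
            ∑ y ∈ Literature.Probability.LatticeModels.halfOpenBox 2 (2 * k),
              (∑ e ∈ insert 0 Literature.MathematicalPhysics.QuantumLattice.unitSteps,
                ‖((Literature.MathematicalPhysics.QuantumLattice.dWaveFormFactor e / Real.sqrt 2 : ℝ) :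
                  ℂ)‖ * 2) ^ 2 :=
          Finset.sum_le_sum fun x _ => Finset.sum_le_sum fun y _ =>
            (Literature.MathematicalPhysics.QuantumLattice.torusPullback_apply _ _ _ _).trans_le
              (hb _ _)
      _ = (∑ e ∈ insert 0 Literature.MathematicalPhysics.QuantumLattice.unitSteps,
              ‖((Literature.MathematicalPhysics.QuantumLattice.dWaveFormFactor e / Real.sqrt 2 : ℝ) :
                ℂ)‖ * 2) ^ 2 *
            ((Literature.Probability.LatticeModels.halfOpenBox 2 (2 * k)).card : ℝ) ^ 2 := by
          simp only [Finset.sum_const, nsmul_eq_mul]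
          ring
  -- (8) `0 < a' ≤ liminf` : d-wave pair-field long-range order along even sides
  exact lt_of_lt_of_le ha' (le_liminf_of_le hco hev)

end Summit.HubbardSuperconductivity.HubbardSuperconductivity.Theses.FixedNodeShadow
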